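/-
Copyright: cell pub-balaban-gaps (YM BLITZ Y1, track G1), seat g1-p2 GEN 8 (unit `pub-balaban-gaps-g1-p2`).  Row (D4) NODE O,
OBJECT ∕ MECHANISM level, CARRIER-GENERIC: the covariant shift `V_W = Δ_1 ⊗ 1 − Δ_W` of [B9] (3.50)–(3.54) (transport defects
`W_b = R(U′_b) − 1`) in (3.52)-STRUCTURED form over ANY finite site type with commuting-free data «cube map + shift permutations +
scale η», its (3.61)-shape domination letter from the two (3.37)-type windows, faithfulness `Δ_1 ⊗ 1 − Δ_W = V_W`, and [B9]
Cor. 3.5's step for it on ANY kernel carrying value + forward-derivative block letters — so that the one-scale carrier of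
`D4WalkBlockCovariantGeometry`∕`…CovariantShift` (59a∕59b, `Site P 0`, `Site.shift`) and the multi-level carrier of junction J-3
(`boxDom N₀`, `tshift`) are two instances.  HONEST FRAMING: elementary matrix bookkeeping; nothing of Bałaban's `U′ = e^{iηA}` ∕
`V′(A)` constructed; (D4) NOT discharged (instance 0∕1); NOT BetaPertH, NOT continuum, NOT Clay.
-/
import Summits.QuantumFields.BalabanUV.Gaps.D4WalkBlockDerivative
import Summits.QuantumFields.BalabanUV.Gaps.D4WalkBlockFlatLetters

/-!
# `Gaps.D4WalkBlockShiftAlgebra` — the covariant shift of [B9] (3.50)–(3.54) over a generic carrier: fibre-diagonal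
# coefficients, row relabellings, the (3.52)-structure, its (3.61) letter, faithfulness, and Cor. 3.5's step
# (cell pub-balaban-gaps, seat g1-p2 gen 8)

HONEST DEPENDENCY (cell pub-balaban, verbatim): continuum YM on T⁴ ⇐ BetaPertH ∧ nine spine estimates (0/9 proved);
BetaPertH ⇐ (D1) ∧ (D4) ∧ CAP+tail.

[B9] p. 400 (3.50): «(Δ_{U′U}λ)(x) = η⁻²Σ_{b∈st(x)}[λ(b₋) − R(U′_bU_b)λ(b₊)]»; (3.52)–(3.54): the perturbation `V′₁(A)` is a sum of
SITE-LOCAL fibre coefficients times covariant differences, «|(V′₁(A)λ)(x)| ≦ 4dα₁(L^jη)^{−1}|∇_Uλ| + 2dα₁(L^jη)^{−2}|λ| + …»;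
(3.61) p. 402.  The seat's 59a∕59b typed this ON `Site P 0 × F`.  THIS FILE abstracts the carrier: a finite site type `X`, a
finite fibre `F`, a cube map `cub : X → UT Kv`, a scale `η > 0`, and for each direction `μ : ι` a shift PERMUTATION
`sh μ : X ≃ X` («`x ↦ x + e_μ`») whose inverse moves the cube by at most one (`d₁(cub(sh μ⁻¹x), cub x) ≤ 1`) — nothing else.
* §1 `fibD w` (the site-local fibre coefficient `[x = y]·w(x)_{ab}`): `fibD_local`, `blockNorm_fibD_le` (diagonal block bound =
  fibre row mass), `fibD_add ∕ _smul ∕ _sum`, `differentiableOn_fibD_entry`;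
* §2 `relab σ` (rows relabelled by a site map: `(relab σ·M)(x,a) = M(σx,a)`): `relab_mul_apply`, `relab_mul_relab`, `relab_id`,
  **`blockNorm_relab_mul_le`** (a decaying block letter survives a one-cube relabelling at the price `e^{ρ}`), `relab_eq_blockDiagonal`;
* §3 the (3.52)-structure: forward ∕ backward shifts `Sfw μ = relab (sh μ)`, `Sbw μ = relab (sh μ)⁻¹`, the forward η-difference
  `Dfw μ = η⁻¹(Sfw μ − 1)` (`⊗ 1_F` built in), `covDop` = {`Dfw μ`, `Sbw μ·Dfw μ`}, letters `covB δ₀` = {1, e^{½δ₀}}, coefficients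
  `covCoeff` (`η⁻¹W⁺_μ`, `−η⁻¹W⁻_μ`), `covCoeff₀` (`η⁻²Σ_μ(W⁺_μ + W⁻_μ)` — the divergence), **`covShift`**;
  **`covShift_dominated`** (BOND window `Σ_b‖W^±_μ(u,x)_{ab}‖ ≤ ηα` + DIVERGENCE window `Σ_b‖(Σ_μW⁺_μ+W⁻_μ)(u,x)_{ab}‖ ≤ η²α′` ⟹
  `‖V_W(u)S‖_{Y,Y′} ≤ α′‖S‖ + Σ_ι α‖D_ιS‖` — NO `η⁻¹`), `covShift_holo`;
The sequel `D4WalkBlockShiftStep` carries faithfulness (`Δ_1 ⊗ 1 − Δ_W = V_W`) and [B9] Cor. 3.5's step for `V_W` on any kernel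
with value + forward-derivative letters.
WHAT IT IS NOT.  The windows FROM (3.37) for `U′ = e^{iηA}`; `F′₂` averaging corrections; any instance (the one-scale instance is
59b's END; the multi-level instance is `D4WalkBlockCovariantShiftMultiLevel`); (D4) instance 0∕1; words of row (D4) UNCHANGED.

References: T. Bałaban, Comm. Math. Phys. **99** (1985) 389–434 [B9], (3.23) p. 394, (3.37) p. 396, (3.50)–(3.54) pp. 400–401,
(3.60)–(3.65) pp. 402–403, Cor. 3.5 p. 407; Comm. Math. Phys. **116** (1988) [II], (1.11) p. 5.
-/

noncomputable section

namespace Summit.QuantumFields.BalabanUV.Gaps.D4WalkBlockShiftAlgebra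

open Metric Set Finset
open scoped Matrix
open Literature.MathematicalPhysics.QuantumFieldTheory.Balaban1983to89
open Literature.MathematicalPhysics.QuantumFieldTheory.Balaban1983to89.B9SectDWalk (DomBy)
open Literature.MathematicalPhysics.QuantumFieldTheory.Balaban1983to89.B9Thm34Ext (toB6)
open Literature.MathematicalPhysics.QuantumFieldTheory.Balaban1983to89.B9Thm37GlueTorus (torusGeom tdist1 tdist1_nonneg tdist1_comm
  tdist1_triangle)
open Literature.MathematicalPhysics.QuantumFieldTheory.Balaban1983to89.TreeLengthTorus (TPt)
open Literature.MathematicalPhysics.QuantumFieldTheory.Balaban1983to89.B5TorusCover (UT)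
open Literature.MathematicalPhysics.QuantumFieldTheory.Balaban1983to89.B11SectG (RowSum)
open Summit.QuantumFields.BalabanUV.Gaps.D4WalkBlock
  (rowMass blockNorm blockNorm_nonneg blockNorm_le_of_rowMass_le rowMass_le_blockNorm BlockWalkExpansion)
open Summit.QuantumFields.BalabanUV.Gaps.D4WalkBlockDerivative
  (blockDominated_of_local differentiableOn_perturb_entry blockWalkExpansion_perturb_of_derivLetters)
open Summit.QuantumFields.BalabanUV.Gaps.D4WalkBlockFlatLetters (blockWalkExpansion_const)

variable {X : Type} {F : Type}
variable {ν : ℕ} {Kv : Fin ν → ℕ}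

/-! ## §1. Site-local fibre coefficients -/

section FibD
variable (X F) [DecidableEq X]

/-- A SITE-LOCAL FIBRE COEFFICIENT: `(fibD w)((x,a),(y,b)) = [x = y]·w(x)_{ab}` (print: `i ad_{A′(b)}`, `F′_{1,k}(i ad_{A′(b)})` acting
in 𝔤 at the site). [cite: Balaban1985BackgroundPropagators, (3.52) p.400] -/
def fibD (w : X → Matrix F F ℂ) : Matrix (X × F) (X × F) ℂ :=
  Matrix.of fun p q => if p.1 = q.1 then w p.1 p.2 q.2 else 0

variable {X F}

/-- `fibD w` is cube-local for every cube map factoring through the site. -/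
theorem fibD_local {Kt : Type} (cub : X → Kt) (w : X → Matrix F F ℂ) (p q : X × F) (h : fibD X F w p q ≠ 0) :
    cub p.1 = cub q.1 := by
  unfold fibD at h
  rw [Matrix.of_apply] at h
  by_cases hpq : p.1 = q.1
  · rw [hpq]
  · exact (h (if_neg hpq)).elim

/-- The diagonal blocks of `fibD w` are bounded by the fibre row masses `Σ_b ‖w(x)_{ab}‖ ≤ β`. -/
theorem blockNorm_fibD_le [Fintype X] [Fintype F] (cub : X → UT Kv) (w : X → Matrix F F ℂ) {β : ℝ} (hβ : 0 ≤ β)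
    (hw : ∀ x a, ∑ b, ‖w x a b‖ ≤ β) (Y : UT Kv) :
    blockNorm (fun p : X × F => cub p.1) (fun p : X × F => cub p.1) (fibD X F w) Y Y ≤ β := by
  classical
  refine blockNorm_le_of_rowMass_le _ _ _ Y Y hβ fun p _ => ?_
  unfold rowMass
  calc ∑ q ∈ Finset.univ.filter (fun q : X × F => cub q.1 = Y), ‖fibD X F w p q‖
      ≤ ∑ q : X × F, ‖fibD X F w p q‖ :=
        Finset.sum_le_sum_of_subset_of_nonneg (Finset.filter_subset _ _) fun _ _ _ => norm_nonneg _
    _ = ∑ q : X × F, if p.1 = q.1 then ‖w p.1 p.2 q.2‖ else 0 := by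
        refine Finset.sum_congr rfl fun q _ => ?_
        unfold fibD; rw [Matrix.of_apply]; split_ifs <;> simp
    _ = ∑ x : X, ∑ b : F, (if p.1 = x then ‖w p.1 p.2 b‖ else 0) := Fintype.sum_prod_type _
    _ = ∑ b : F, ‖w p.1 p.2 b‖ := by
        rw [Finset.sum_comm]
        exact Finset.sum_congr rfl fun b _ => by rw [Finset.sum_ite_eq]; simp
    _ ≤ β := hw p.1 p.2

/-- `fibD` is additive. -/
theorem fibD_add (w w' : X → Matrix F F ℂ) : fibD X F (fun x => w x + w' x) = fibD X F w + fibD X F w' := by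
  ext p q; simp only [fibD, Matrix.of_apply, Matrix.add_apply]; split_ifs <;> simp

/-- `fibD` commutes with scalars. -/
theorem fibD_smul (c : ℂ) (w : X → Matrix F F ℂ) : fibD X F (fun x => c • w x) = c • fibD X F w := by
  ext p q; simp only [fibD, Matrix.of_apply, Matrix.smul_apply, smul_eq_mul]; split_ifs <;> simp

/-- `fibD` commutes with finite sums. -/
theorem fibD_sum {κ : Type*} (s : Finset κ) (w : κ → X → Matrix F F ℂ) :
    fibD X F (fun x => ∑ i ∈ s, w i x) = ∑ i ∈ s, fibD X F (w i) := by
  ext p q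
  simp only [fibD, Matrix.of_apply, Matrix.sum_apply]
  split_ifs with h
  · rfl
  · simp

/-- Entries of a site-local fibre coefficient family are holomorphic when the fibre entries are. -/
theorem differentiableOn_fibD_entry {E : Type*} [NormedAddCommGroup E] [NormedSpace ℂ E] {s : Set E}
    {w : E → X → Matrix F F ℂ} (hw : ∀ x a b, DifferentiableOn ℂ (fun u => w u x a b) s) (p q : X × F) :
    DifferentiableOn ℂ (fun u => fibD X F (w u) p q) s := by
  unfold fibD
  simp only [Matrix.of_apply]
  split_ifs
  · exact hw _ _ _
  · exact differentiableOn_const _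

end FibD

/-! ## §2. Row relabellings by a site map -/

section Relab
variable (X F) [Fintype X] [Fintype F] [DecidableEq X] [DecidableEq F]

/-- ROW RELABELLING by a site map `σ`: `(relab σ·M)(x,a) = M(σx, a)` — for `σ = (· + e_μ)` the fibred forward shift `S_μ ⊗ 1_F`,
for `σ = (· − e_μ)` the backward shift `S⁻_μ ⊗ 1_F`. [cite: Balaban1985BackgroundPropagators, (3.50) p.400] -/
def relab (σ : X → X) : Matrix (X × F) (X × F) ℂ := Matrix.of fun p q => if q = (σ p.1, p.2) then 1 else 0

variable {X F}

/-- Rows of `relab σ·M` are rows of `M` at the relabelled site. -/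
theorem relab_mul_apply (σ : X → X) (M : Matrix (X × F) (X × F) ℂ) (p q : X × F) :
    (relab X F σ * M) p q = M (σ p.1, p.2) q := by
  classical
  rw [Matrix.mul_apply]
  unfold relab
  simp only [Matrix.of_apply, ite_mul, one_mul, zero_mul]
  rw [Finset.sum_ite_eq' Finset.univ (σ p.1, p.2) (fun r => M r q)]
  simp

/-- Relabellings compose (contravariantly). -/
theorem relab_mul_relab (σ τ : X → X) : relab X F σ * relab X F τ = relab X F (τ ∘ σ) := by
  ext p q
  rw [relab_mul_apply]
  unfold relab
  simp only [Matrix.of_apply, Function.comp_apply]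
  by_cases h : q = (τ (σ p.1), p.2) <;> simp [h]

omit [Fintype X] [Fintype F] in
/-- The identity relabelling is `1`. -/
theorem relab_id : relab X F id = (1 : Matrix (X × F) (X × F) ℂ) := by
  classical
  ext p q
  simp only [relab, Matrix.of_apply, id, Matrix.one_apply]
  by_cases h : p = q
  · subst h; simp
  · have : ¬ q = (p.1, p.2) := fun h' => h (by rw [h']); simp [h, this]

omit [Fintype X] [Fintype F] in
/-- `relab σ = P_σ ⊗ 1_F` with the site permutation matrix `P_σ(x, y) = [y = σx]`. -/
theorem relab_eq_blockDiagonal (σ : X → X) :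
    relab X F σ = Matrix.blockDiagonal fun _ : F => (Matrix.of fun x y : X => if y = σ x then (1 : ℂ) else 0) := by
  classical
  ext p q
  rw [show p = (p.1, p.2) from rfl, show q = (q.1, q.2) from rfl, Matrix.blockDiagonal_apply]
  simp only [relab, Matrix.of_apply, Prod.mk.injEq]
  by_cases h2 : p.2 = q.2
  · by_cases h1 : q.1 = σ p.1
    · simp [h1, h2]
    · simp [h1, h2]
  · have h2' : ¬ q.2 = p.2 := fun h => h2 h.symm
    simp [h2, h2']

/-- **A DECAYING BLOCK LETTER SURVIVES A ONE-CUBE RELABELLING** at the price `e^{ρ}`: if `σ` moves the cube by at most one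
(`d₁(cub(σx), cub x) ≤ 1`) and `‖M‖_{Y,Y′} ≤ Ae^{−ρd₁(Y,Y′)}` for all cubes (`A, ρ ≥ 0`), then `‖relab σ·M‖_{Y,Y′} ≤ Ae^{ρ}·e^{−ρd₁(Y,Y′)}`. -/
theorem blockNorm_relab_mul_le [∀ i, NeZero (Kv i)] (cub : X → UT Kv) (σ : X → X)
    (hσ : ∀ x, tdist1 Kv (cub (σ x)) (cub x) ≤ 1) (M : Matrix (X × F) (X × F) ℂ) {A ρ : ℝ} (hA : 0 ≤ A) (hρ : 0 ≤ ρ)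
    (hM : ∀ Y Y', blockNorm (fun p : X × F => cub p.1) (fun p : X × F => cub p.1) M Y Y' ≤ A * Real.exp (-(ρ * tdist1 Kv Y Y')))
    (Y Y' : UT Kv) :
    blockNorm (fun p : X × F => cub p.1) (fun p : X × F => cub p.1) (relab X F σ * M) Y Y' ≤
      (A * Real.exp ρ) * Real.exp (-(ρ * tdist1 Kv Y Y')) := by
  refine blockNorm_le_of_rowMass_le _ _ _ Y Y' (by positivity) fun p hp => ?_
  have e : rowMass (fun p : X × F => cub p.1) (relab X F σ * M) p Y' = rowMass (fun p : X × F => cub p.1) M (σ p.1, p.2) Y' := by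
    unfold rowMass
    exact Finset.sum_congr rfl fun q _ => by rw [relab_mul_apply]
  rw [e]
  set Y'' := cub (σ p.1) with hY''
  have h1 : tdist1 Kv Y'' Y ≤ 1 := by rw [hY'', ← hp]; exact hσ p.1
  have h2 : tdist1 Kv Y Y' ≤ 1 + tdist1 Kv Y'' Y' := by
    have := tdist1_triangle (N := Kv) Y Y'' Y'
    rw [tdist1_comm Y Y''] at this
    linarith
  calc rowMass (fun p : X × F => cub p.1) M (σ p.1, p.2) Y'
      ≤ blockNorm (fun p : X × F => cub p.1) (fun p : X × F => cub p.1) M Y'' Y' := rowMass_le_blockNorm _ _ M _ Y'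
    _ ≤ A * Real.exp (-(ρ * tdist1 Kv Y'' Y')) := hM Y'' Y'
    _ ≤ (A * Real.exp ρ) * Real.exp (-(ρ * tdist1 Kv Y Y')) := by
        rw [mul_assoc, ← Real.exp_add]
        exact mul_le_mul_of_nonneg_left (Real.exp_le_exp.2 (by nlinarith)) hA

end Relab

/-! ## §3. The covariant shift in (3.52)-structured form; its (3.61) letter; holomorphy -/

section CovShift
variable (X F) [Fintype X] [Fintype F] [DecidableEq X] [DecidableEq F] {ι : Type} [Fintype ι] (sh : ι → X ≃ X) (η : ℝ)
variable {E : Type*} [NormedAddCommGroup E] [NormedSpace ℂ E]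

/-- The fibred FORWARD shift `S_μ ⊗ 1_F`: `(Sλ)(x,a) = λ(x + e_μ, a)`. -/
def Sfw (μ : ι) : Matrix (X × F) (X × F) ℂ := relab X F (sh μ)

/-- The fibred BACKWARD shift `S⁻_μ ⊗ 1_F`: `(S⁻λ)(x,a) = λ(x − e_μ, a)`. -/
def Sbw (μ : ι) : Matrix (X × F) (X × F) ℂ := relab X F (sh μ).symm

/-- The fibred forward η-difference `∂^η_μ ⊗ 1_F = η⁻¹(S_μ − 1) ⊗ 1_F`. [cite: Balaban1985BackgroundPropagators, (3.23) p.394] -/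
def Dfw (μ : ι) : Matrix (X × F) (X × F) ℂ := ((η : ℂ)⁻¹) • (Sfw X F sh μ - 1)

/-- The difference operators of the (3.52)-structure: forward `∂_μ ⊗ 1` and backward-relabelled `S⁻_μ(∂_μ ⊗ 1)`. -/
def covDop : ι ⊕ ι → Matrix (X × F) (X × F) ℂ
  | Sum.inl μ => Dfw X F sh η μ
  | Sum.inr μ => Sbw X F sh μ * Dfw X F sh η μ

/-- The relative derivative letters of `covDop` at walk rate `ρ`: `1` forward, `e^{ρ}` backward (one-cube relabelling). -/
def covB (ρ : ℝ) : ι ⊕ ι → ℝ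
  | Sum.inl _ => 1
  | Sum.inr _ => Real.exp ρ

variable (Wp Wm : ι → E → X → Matrix F F ℂ)

/-- The first-order coefficients: `η⁻¹W⁺_μ(u,x)` on `∂_μ ⊗ 1`, `−η⁻¹W⁻_μ(u,x)` on `S⁻_μ∂_μ ⊗ 1`.
[cite: Balaban1985BackgroundPropagators, (3.52) p.400] -/
def covCoeff : ι ⊕ ι → E → Matrix (X × F) (X × F) ℂ
  | Sum.inl μ => fun u => fibD X F fun x => ((η : ℂ)⁻¹) • Wp μ u x
  | Sum.inr μ => fun u => fibD X F fun x => (-((η : ℂ)⁻¹)) • Wm μ u x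

/-- The zeroth-order coefficient `η⁻²Σ_μ(W⁺_μ + W⁻_μ)(u,x)` — the DIVERGENCE of the defects.
[cite: Balaban1985BackgroundPropagators, (3.52) p.400, (3.54) p.401] -/
def covCoeff₀ : E → Matrix (X × F) (X × F) ℂ :=
  fun u => fibD X F fun x => (((η : ℂ)⁻¹) ^ 2) • ∑ μ, (Wp μ u x + Wm μ u x)

/-- **THE COVARIANT SHIFT `V_W(u) = Δ_1 ⊗ 1 − Δ_W(u)`** in the (3.52)-structured form `a₀(u) + Σ_ι a_ι(u)·D_ι`.
[cite: Balaban1985BackgroundPropagators, (3.50)–(3.53) pp.400–401] -/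
def covShift (u : E) : Matrix (X × F) (X × F) ℂ :=
  covCoeff₀ X F η Wp Wm u + ∑ j, covCoeff X F η Wp Wm j u * covDop X F sh η j

variable {X F sh η Wp Wm}

omit [Fintype X] [Fintype F] [DecidableEq F] [Fintype ι] [NormedAddCommGroup E] [NormedSpace ℂ E] in
/-- unfolding of the forward coefficient. -/
theorem covCoeff_inl (μ : ι) (u : E) :
    covCoeff X F η Wp Wm (Sum.inl μ) u = fibD X F fun x => ((η : ℂ)⁻¹) • Wp μ u x := rfl

omit [Fintype X] [Fintype F] [DecidableEq F] [Fintype ι] [NormedAddCommGroup E] [NormedSpace ℂ E] in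
/-- unfolding of the backward coefficient. -/
theorem covCoeff_inr (μ : ι) (u : E) :
    covCoeff X F η Wp Wm (Sum.inr μ) u = fibD X F fun x => (-((η : ℂ)⁻¹)) • Wm μ u x := rfl

omit [DecidableEq F] in
/-- the fibre row masses of a scaled family. -/
private theorem sum_norm_smul_le {w : Matrix F F ℂ} (c : ℂ) {β : ℝ} (a : F) (h : ∑ b, ‖w a b‖ ≤ β) :
    ∑ b, ‖(c • w) a b‖ ≤ ‖c‖ * β := by
  calc ∑ b, ‖(c • w) a b‖ = ‖c‖ * ∑ b, ‖w a b‖ := by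
        rw [Finset.mul_sum]; exact Finset.sum_congr rfl fun b _ => by rw [Matrix.smul_apply, smul_eq_mul, norm_mul]
    _ ≤ ‖c‖ * β := mul_le_mul_of_nonneg_left h (norm_nonneg c)

omit [NormedSpace ℂ E] in
/-- **THE (3.61)-SHAPE DOMINATION LETTER OF `V_W` FROM THE TWO WINDOWS** (`η > 0`).  BOND window `Σ_b‖W^±_μ(u,x)_{ab}‖ ≤ ηα`;
DIVERGENCE window `Σ_b‖(Σ_μ W⁺_μ + W⁻_μ)(u,x)_{ab}‖ ≤ η²α′` ⟹ for every cube map through the site and every `S`: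
`‖V_W(u)S‖_{Y,Y′} ≤ α′‖S‖_{Y,Y′} + Σ_ι α‖D_ιS‖_{Y,Y′}` — the coefficients' `η⁻¹`, `η⁻²` are eaten by the windows.
[cite: Balaban1985BackgroundPropagators, (3.54) p.401, (3.61) p.402, (3.37) p.396] -/
theorem covShift_dominated [∀ i, NeZero (Kv i)] (cub : X → UT Kv) (hη : 0 < η) {R α α' : ℝ} (hα : 0 ≤ α) (hα' : 0 ≤ α')
    (hWp : ∀ μ, ∀ u ∈ ball (0 : E) R, ∀ x a, ∑ b, ‖Wp μ u x a b‖ ≤ η * α)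
    (hWm : ∀ μ, ∀ u ∈ ball (0 : E) R, ∀ x a, ∑ b, ‖Wm μ u x a b‖ ≤ η * α)
    (hdiv : ∀ u ∈ ball (0 : E) R, ∀ x a, ∑ b, ‖(∑ μ, (Wp μ u x + Wm μ u x)) a b‖ ≤ η ^ 2 * α') :
    ∀ u ∈ ball (0 : E) R, ∀ (S : Matrix (X × F) (X × F) ℂ) (Y Y' : UT Kv),
      blockNorm (fun p : X × F => cub p.1) (fun p : X × F => cub p.1) (covShift X F sh η Wp Wm u * S) Y Y' ≤
        α' * blockNorm (fun p : X × F => cub p.1) (fun p : X × F => cub p.1) S Y Y' +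
          ∑ j, α * blockNorm (fun p : X × F => cub p.1) (fun p : X × F => cub p.1) (covDop X F sh η j * S) Y Y' := by
  intro u hu S Y Y'
  have hnorm : ‖((η : ℂ)⁻¹)‖ = η⁻¹ := by rw [norm_inv, Complex.norm_real, Real.norm_eq_abs, abs_of_pos hη]
  have hloc₀ : ∀ p q, covCoeff₀ X F η Wp Wm u p q ≠ 0 → cub p.1 = cub q.1 := fun p q h => fibD_local cub _ p q h
  have hloc : ∀ j p q, covCoeff X F η Wp Wm j u p q ≠ 0 → cub p.1 = cub q.1 := fun j p q h => by
    cases j with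
    | inl μ => rw [covCoeff_inl] at h; exact fibD_local cub _ p q h
    | inr μ => rw [covCoeff_inr] at h; exact fibD_local cub _ p q h
  have hbd₀ : ∀ Y, blockNorm (fun p : X × F => cub p.1) (fun p : X × F => cub p.1) (covCoeff₀ X F η Wp Wm u) Y Y ≤ α' :=
    fun Y => by
    unfold covCoeff₀
    refine blockNorm_fibD_le cub _ hα' (fun x a => (sum_norm_smul_le _ a (hdiv u hu x a)).trans ?_) Y
    rw [norm_pow, hnorm, ← mul_assoc, inv_pow, inv_mul_cancel₀ (pow_ne_zero 2 hη.ne'), one_mul]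
  have hbd : ∀ j Y, blockNorm (fun p : X × F => cub p.1) (fun p : X × F => cub p.1) (covCoeff X F η Wp Wm j u) Y Y ≤ α :=
    fun j Y => by
    cases j with
    | inl μ =>
        rw [covCoeff_inl]
        refine blockNorm_fibD_le cub _ hα (fun x a => (sum_norm_smul_le _ a (hWp μ u hu x a)).trans ?_) Y
        rw [hnorm, ← mul_assoc, inv_mul_cancel₀ hη.ne', one_mul]
    | inr μ =>
        rw [covCoeff_inr]
        refine blockNorm_fibD_le cub _ hα (fun x a => (sum_norm_smul_le _ a (hWm μ u hu x a)).trans ?_) Y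
        rw [norm_neg, hnorm, ← mul_assoc, inv_mul_cancel₀ hη.ne', one_mul]
  exact blockDominated_of_local (fun p : X × F => cub p.1) (fun p : X × F => cub p.1) (covDop X F sh η)
    (covCoeff₀ X F η Wp Wm u) (fun j => covCoeff X F η Wp Wm j u) (α := fun _ => α) hloc₀ hbd₀ hloc hbd S Y Y'

/-- `V_W(u)` is entrywise holomorphic when the defects are. [cite: Balaban1985BackgroundPropagators, p.400 («analytic function of A(b)»), Thm 3.4 p.400] -/
theorem covShift_holo {R : ℝ} (hWp : ∀ μ x a b, DifferentiableOn ℂ (fun u => Wp μ u x a b) (ball (0 : E) R))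
    (hWm : ∀ μ x a b, DifferentiableOn ℂ (fun u => Wm μ u x a b) (ball (0 : E) R)) :
    ∀ p q, DifferentiableOn ℂ (fun u => covShift X F sh η Wp Wm u p q) (ball (0 : E) R) := by
  intro p q
  refine differentiableOn_perturb_entry (E := E) (Dop := covDop X F sh η) (a₀ := covCoeff₀ X F η Wp Wm)
    (a := fun j u => covCoeff X F η Wp Wm j u) (fun i k => ?_) (fun j i l => ?_) p q
  · refine differentiableOn_fibD_entry (w := fun u x => (((η : ℂ)⁻¹) ^ 2) • ∑ μ, (Wp μ u x + Wm μ u x))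
      (fun x a b => ?_) i k
    simp only [Matrix.smul_apply, smul_eq_mul, Matrix.sum_apply, Matrix.add_apply]
    exact (differentiableOn_const _).mul (DifferentiableOn.fun_sum fun μ _ => (hWp μ x a b).add (hWm μ x a b))
  · cases j with
    | inl μ =>
        refine differentiableOn_fibD_entry (w := fun u x => ((η : ℂ)⁻¹) • Wp μ u x) (fun x a b => ?_) i l
        simp only [Matrix.smul_apply, smul_eq_mul]
        exact (differentiableOn_const _).mul (hWp μ x a b)
    | inr μ =>
        refine differentiableOn_fibD_entry (w := fun u x => (-((η : ℂ)⁻¹)) • Wm μ u x) (fun x a b => ?_) i l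
        simp only [Matrix.smul_apply, smul_eq_mul]
        exact (differentiableOn_const _).mul (hWm μ x a b)

end CovShift

end Summit.QuantumFields.BalabanUV.Gaps.D4WalkBlockShiftAlgebra

end
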